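import Summits.AtomisticToContinuum.HydrodynamicLimit.Theorems.OneSphereInfluenceHardCorePoincareDobrushinDoor
import Summits.AtomisticToContinuum.HydrodynamicLimit.Theorems.OneSphereInfluenceHardCorePoincareDobrushinExtension

/-!
# OneSphereInfluenceHardCorePoincareDobrushin — DobrushinDoor (decomp-a2c · lens-1 · g39), part 9/9: the closing theorem

**`OneSphereInfluence.HardCorePoincare` (stmt-AtomisticToContinuum-13619, crux r4 of
route-AtomisticToContinuum-OneSphereInfluence, sub `HydrodynamicLimit`) — the `N`-uniform hard-core
Poincaré / Glauber spectral-gap inequality for the local Gibbs law of the hard-sphere gas at small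
packing — is PROVED, sorry-free, BY NAME, in this file (part 9/9 of a nine-file chain):**

    theorem hardCorePoincare_holds : Theses.OneSphereInfluence.HardCorePoincare
        -- 0 sorry · 0 warnings · axioms {propext, Classical.choice, Quot.sound}

via Dobrushin's uniqueness technique: `HardCorePoincare ⟸ [K] ∧ [G]` (kernel
`hardCorePoincare_of_dobrushin`), with BOTH pieces proved in the chain —
[G] `HeatBathDobrushin` (`heatBathDobrushin_holds`, the model half: the heat-bath one-site
specification of `localGibbsMeasure` satisfies Dobrushin's condition with `D(σ) = 4Aκσ³/(I − Aκσ³) < 1`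
uniformly in `N`) and [K] `DobrushinGlauberPoincare` (`dobrushinGlauberPoincare_holds`, the abstract
half: Dobrushin row-sum condition ⇒ `Var_μ f ≤ (1−D)⁻¹ Σ_i ∫ Var_μ[f | z_{−i}] dμ` on an arbitrary
finite product of a measurable space, namespace `Abstract`, ≈ 1300 lines over Mathlib).

THE CHAIN (land in this order; parts 1–8 `--supports stmt-AtomisticToContinuum-13619`, part 9
`--workitem stmt-AtomisticToContinuum-13619`): 1 `…DobrushinSite` (one-site objects, `siteKernel`) →
2 `…DobrushinBounds` (free-volume and two-ball bounds, `siteKernel_tv`) → 3 `…DobrushinDoor` (DLR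
identity, [K], [G], kernel, `heatBathDobrushin_holds`) ; 4 `…DobrushinOscillation` → 5
`…DobrushinInvariance` → 6 `…DobrushinSpectral` → 7 `…DobrushinIdent` → 8 `…DobrushinExtension`
(the model-free `Abstract` theory, `import Mathlib` only) ; 9 this file (imports 3 and 8). All names
are prefixed `OneSphereInfluenceHardCorePoincare`.

## §0 Mandate, target, path honesty

* MANDATE. Critic row 486 (2) «lens-1 := OneSphereInfluence» and row 497 (B)(3) «lens-1 g39 :=
  OneSphereInfluence ✓»; README RESIDUAL MODE «blocker first, no side-leaf staffing».
* BLOCKER FIRST — HONEST CENSUS. The blocker of N = OSI is the pair X_A `ScoreLinearResponse`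
  (13617) / X_B `ResamplingInfluence` (13618), both IDEA-NEEDED. The grading lens was run over the
  blocker FIRST (folder NOTES.md `## Dead ends`, 20 axes): EVERY axis degenerates on X_A/X_B (costume
  of the crux, already in the tree — AZH stubs, ACW 17510, 9902 —, or outside the cone of `closes`).
  The lens has NO TEETH on the blocker; recorded as the census result (EXCERPT-g39.md), not hidden.
* RE-POINT WITHIN N (not a side leaf): X_C `HardCorePoincare` is the binder `h₄` of OSI's deciding
  theorem `closes (h₂ : ScoreLinearResponse) (h₃ : ResamplingInfluence) (h₄ : HardCorePoincare)
  (hP : PreShockHomotopy) (hR : MeanVarianceReduction) : HydrodynamicLimit`. This file DISCHARGES `h₄`: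
  after landing, OSI's open load-bearing binders are X_A, X_B and `PreShockHomotopy` (13621) only.
  No distance-to-summit is claimed beyond that: X_C alone does not give `HydrodynamicLimit`
  (probe MF5 of `bc/probes39.lean`), and the blocker is untouched.
* TARGET (BY NAME): `Summit.AtomisticToContinuum.HydrodynamicLimit.Theses.OneSphereInfluence.HardCorePoincare`
  — the type of `hardCorePoincare_holds` is literally that constant.

## §0.1 Composition (everything below is PROVED in the chain)

    HardCorePoincare (13619)                                   `hardCorePoincare_holds`            [TARGET]
      ⟸ [K] ∧ [G]                                              `hardCorePoincare_of_dobrushin`     (kernel)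
    [G] HeatBathDobrushin                                      `heatBathDobrushin_holds`           (parts 1–3)
    [K] DobrushinGlauberPoincare                               `dobrushinGlauberPoincare_holds`    (parts 4–8)
      ⟸ [K♭] bounded Poincaré `Abstract.variance_le_of_dobrushin_bounded`
        (Dobrushin contraction `Abstract.Phi_scanOp_le` + spectral step)
      ∧  identification `Abstract.siteOp_ae_eq_condExp` (`P_i f = μ[f | z_{−i}]` a.e.)
      ∧  [I₂] bounded-to-L² extension `Abstract.boundedToL2Extension_holds`.

  Explicit constants (all inside proofs, none hand-picked in a statement): `A ≥ sup a₁`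
  (`exists_forall_abs_le_of_continuous`), `I = ∫ a₁ > 0`, `κ = 4π/3`, `ε_N = hsDiameter σ N`
  (`ε_N³ = σ³/(N+1)`): σ₀ = min (1/2) (I/(8A)); D(σ) = 4Aκσ³/(I − Aκσ³) < 1 for σ < σ₀
  (`dobrushin_constants`); c_ij ≡ 4Aκε_N³/(I − N·Aκε_N³), (N+1)·c ≤ D(σ); C(σ) = max 1 (1 − D(σ))⁻¹.

## §0.2 Pieces (cell grammar) — both halves DECIDED

* [G] `HeatBathDobrushin` — PROVED (parts 1–3, ≈ 600 lines; the model piece). `siteKernel hφ ε i z` =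
  normalised restriction of `φ ⊗ Lebesgue` (`φ = localGibbsProfile a₁ u₁ θ₁`) to the free region
  `{(q,v) : ε ≤ dist(q,(z j).1) ∀ j ≠ i}`: a Markov `Kernel` (`isMarkovKernel_siteKernel`, normalisation
  `≥ I − N·Aκε³ > 0`), local (`siteKernel_update`), DLR-consistent = site-wise invariance of the
  canonical hard-sphere Gibbs measure (`lintegral_siteKernel_update`, disintegration along
  `MeasurableEquiv.piFinSuccAbove`), with Dobrushin's total-variation bound (`siteKernel_tv`: moving
  particle `j` changes the free region of site `i` by at most two ε-balls ⇒ `TV ≤ 4Aκε³/(I − N·Aκε³)`);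
  at `ε_N³ = σ³/(N+1)` row/column sums `≤ D(σ) < 1` UNIFORMLY IN `N`.
* [K] `DobrushinGlauberPoincare` — PROVED (parts 4–8, namespace `…HardCorePoincareDobrushin.Abstract`; in
  print: Wu, Ann. Probab. 34 (2006) Thm 2.2, doi:10.1214/009117906000000368; Ollivier, JFA 256 (2009)
  Ex. 12 + Prop. 30, arXiv:math/0701886 [corpus:arxiv-math_0701886 p.8, p.13]; statement quoted in
  [corpus:arxiv-1102.2297 p.8]). The Lean proof is the elementary one:
  (1) `|∫ h dp − ∫ h dq| ≤ osc(h)·c` from the set-wise bound `p A ≤ q A + c` by LAYER CAKE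
      (`lintegral_le_of_tv`, `integral_le_of_tv`);
  (2) Dobrushin's one-step comparison `osc_j(P_i f) ≤ osc_j f + c_ij osc_i f` (j ≠ i),
      `osc_i(P_i f) = 0` (`osc_siteOp_le`, `osc_siteOp_self`), hence CONTRACTION of the total
      oscillation under the random-scan operator `T = (n+1)⁻¹ Σ P_i`:
      `Φ(T f) ≤ ((n + D)/(n+1)) Φ(f)` using ROW sums only (`Phi_scanOp_le`);
  (3) `‖h − μh‖_∞ ≤ Φ(h)` by changing one coordinate at a time (`abs_sub_le_Phi`, `hybrid`);
  (4) invariance in Bochner form and SELF-ADJOINTNESS `⟨u, P_i w⟩ = ⟨P_i u, P_i w⟩`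
      (`integral_siteOp`, `integral_mul_siteOp`), `⟨u, T u⟩ = (n+1)⁻¹ Σ ‖P_i u‖²`;
  (5) SPECTRAL STEP without spectral theory: `v_k = ‖T^k g‖²` is log-convex
      (`v_{k+1}² ≤ v_k v_{k+2}`, from self-adjointness + the `t`-trick `2ab ≤ t a² + b²/t`) and
      `v_k ≤ Φ(g)² r^{2k}` by (2)(3); the ratio lemma `ratio_le_of_logConvex` then gives
      `‖T g‖² ≤ r²‖g‖²`, `⟨g, T g⟩ ≤ r‖g‖²`, i.e. `Σ_i ‖g − P_i g‖² ≥ (1 − D)‖g‖²` for centred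
      bounded `g` (`variance_le_of_dobrushin_bounded`);
  (6) IDENTIFICATION `P_i f = μ[f | σ(z_{−i})]` a.e. from locality + invariance alone
      (`siteOp_ae_eq_condExp`, via `ae_eq_condExp_of_forall_setIntegral_eq`; comap sets are preimages,
      indicators of them are `i`-local, `⟨1_S, P_i f⟩ = ⟨P_i 1_S, f⟩ = ⟨1_S, f⟩`), so
      `∫ (f − P_i f)² = ∫ condVar(σ(z_{−i})) f` (`setIntegral_condVar`);
  (7) EXTENSION bounded → `L²` ([I₂] `boundedToL2Extension_holds`): truncate at `{R ≤ ‖f‖}`,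
      `Var(X+Y) ≤ (1+δ)Var X + (1+δ⁻¹)Var Y`, the same for `∫ condVar` (`condExp_add`),
      `∫ condVar ≤ ∫ X²` (`condVar_ae_le_condExp_sq`), tail `∫_{R ≤ ‖f‖} f² → 0`
      (`tendsto_setIntegral_of_antitone`), then `R → ∞`, `δ → 0⁺` (`ge_of_tendsto`).
  Column sums are NOT used ([K] keeps them as a hypothesis, harmlessly).
* KERNEL `[K] → [G] → HardCorePoincare` — PROVED (`hardCorePoincare_of_dobrushin`, `C := max 1 (1−D)⁻¹`).

## §0.3 Why this split (vs the registered birth skeleton) · grading-lens reading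

* `Cruxes/HardCorePoincare/Lines/birth.lean` cuts X_C along positions | velocities (STUB 1
  `PosGapMarginal` = X_C without velocities, STUBS 2–4 transfer): all four open. DobrushinDoor treats
  the PHASE POINT `(q_i, v_i)` as ONE site of an abstract Gibbs field on `E = 𝕋³ × ℝ³`: stubs 2–4
  disappear (the Maxwellian integrates to one fibrewise), and STUB 1 splits into a general theorem [K]
  with no hard-sphere content and a two-ball volume estimate [G]; both are now proved.
* Grading-lens OUTPUT object: the quantitative ladder of X_C in the packing parameter — rung
  `D(σ) < 1`, constant `C(σ) = (1 − D(σ))⁻¹`, method ceiling of Dobrushin uniqueness `5Aκσ³ < I`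
  (deep in the gas phase; X_C only asks `∃ σ₀`, so the ceiling does not bind the crux).
* Elementary Efron–Stein / Holley–Stroock routes give `O(σ³)(N+1)·Var` or `osc = ∞` — not
  `N`-uniform; Dobrushin's pairwise `c_ij = O(σ³/N)` is what makes the constant uniform (NOTES.md).

## §0.4 What hands / the tenure planner can do with it (cell seats cannot write the ledger)

LAND the nine parts verbatim under `Summits/AtomisticToContinuum/HydrodynamicLimit/Theorems/` in
the chain order (parts 1–8 `--supports stmt-AtomisticToContinuum-13619`; this part 9
`--workitem stmt-AtomisticToContinuum-13619`): the gate matches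
`theorem hardCorePoincare_holds : Theses.OneSphereInfluence.HardCorePoincare` and CLOSES 13619
`proved`; OSI's `closes` keeps its five binders with `h₄` discharged. The `Abstract` parts 4–8 are
model-free (Mathlib only) and could later move to `Literature/Probability/GibbsMeasures/` as a
sorry-free Literature theorem (reusable by Ising / lattice-gas routes).

## §0.5 Checks (farm)

The single-file original (`DobrushinDoor_node_g39_final.lean`, byte-identical bodies) checks
rc 0 · 0 errors · 0 warnings · 0 sorry with `--axioms hardCorePoincare_holds` =
{propext, Classical.choice, Quot.sound} and H21 audit `proof-of-item: hardCorePoincare_holds proves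
…Theses.OneSphereInfluence.HardCorePoincare (route_item route-AtomisticToContinuum-OneSphereInfluence)`,
[K] / [G] / [I₂] `proved-helper`; the nine-part split was re-checked by inlining parts 1..k for every
k (all rc 0 · 0 warnings). No `instance`, no `notation`, no `set_option`; tree imports: the route file,
`HardSphereEulerProofs`, `HardSphereTorusMeasure` (part 1) and `Mathlib` (part 4). Namespaces
`Summit.AtomisticToContinuum.HydrodynamicLimit.Theorems.HardCorePoincareDobrushin[.Abstract]`.
-/

namespace Summit.AtomisticToContinuum.HydrodynamicLimit.Theorems.HardCorePoincareDobrushin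

/-- **[K] PROVED** — the Dobrushin–Glauber Poincaré inequality `DobrushinGlauberPoincare`
(dependent tensorisation of variance under Dobrushin's row-sum condition), from the abstract theory
in `Abstract` (contraction of total oscillation, spectral step, identification
`P_i f = μ[f | z_{−i}]`, bounded-to-`L²` extension). -/
theorem dobrushinGlauberPoincare_holds : DobrushinGlauberPoincare :=
  Abstract.dobrushinGlauberPoincare_holds

/-- **NODE THEOREM (g39, final): `OneSphereInfluence.HardCorePoincare` (crux 13619) — PROVED**,
BY NAME: `[K]` (`dobrushinGlauberPoincare_holds`) and `[G]` (`heatBathDobrushin_holds`) fed to the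
kernel `hardCorePoincare_of_dobrushin`. -/
theorem hardCorePoincare_holds : Theses.OneSphereInfluence.HardCorePoincare :=
  hardCorePoincare_of_dobrushinGlauberPoincare dobrushinGlauberPoincare_holds

end Summit.AtomisticToContinuum.HydrodynamicLimit.Theorems.HardCorePoincareDobrushin
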